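import Mathlib
import Summits.ValiantsHypothesis.ValiantsHypothesis.Theorems.NewtonUnitEquationsDissociatedUniformStubExposedGenericDirection

/-!
# `NewtonUnitEquationsNewtonTauWeakShadowAdditivity` — hull vertices versus unique maximisers

Registered stub `ncard_extremePoints_le_card_uniqueMax` of line `binomial-normal-form` (crux `NewtonTauWeak`,
stmt-ValiantsHypothesis-5904), QUASI rung (Minkowski/union subadditivity ⇒ quasi-polynomial hull counts): the planar
glue "vertices = upper vertices + lower vertices + leftmost + rightmost".

Setting.  `S ⊆ ℕ²` is a finite set of lattice points, embedded in `ℝ²` by `e ↦ (i ↦ (e i : ℝ))`; write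
`x s = (s 0 : ℝ)` and `y s = (s 1 : ℝ)`.  The abstract operator `U σ S` (axiomatised by the hypothesis `hU`) is the
set of points `s ∈ S` which are the UNIQUE maximiser over `S` of the height `f_{t,σ} = t·x + σ·y` for some real
slope `t`.  Claim: the convex hull of the embedded set has at most `|U 1 S| + |U (-1) S| + 2` extreme points.

Proof.  Every extreme point `e` of the hull is `emb e₀` for a point `e₀ ∈ S` which is the strict maximiser over `S`
of a linear height `w 0 · x + w 1 · y`
(`NewtonUnitEquationsDissociatedUniform.stub_exposedGenericDirection` with `T = ∅`, sums expanded by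
`Fin.sum_univ_two`).  According to the sign of `w 1`:
* `0 < w 1`: dividing by `w 1`, `e₀` is the unique maximiser of `(w 0 / w 1)·x + 1·y`, so `e₀ ∈ U 1 S`;
* `w 1 < 0`: dividing by `-w 1`, `e₀` is the unique maximiser of `(w 0 / (-w 1))·x + (-1)·y`, so `e₀ ∈ U (-1) S`;
* `w 1 = 0`, `0 < w 0`: `e₀` is the unique rightmost point of `S` (strictly largest `x`);
* `w 1 = 0`, `w 0 < 0`: `e₀` is the unique leftmost point of `S`;
* `w = 0`: strict exposure reads `0 < 0` for every other point, so `S = {e₀}` and `e₀` is (vacuously) the unique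
  rightmost point.
Hence the extreme points lie in the image of `U 1 S ∪ U (-1) S ∪ Mx ∪ Mn`, where `Mx`, `Mn` (the unique rightmost,
resp. leftmost, points) have at most one element each (two distinct members would each have strictly larger `x`
than the other), and `ncard ≤ card` of that finset `≤ |U 1 S| + |U (-1) S| + 1 + 1` by `Finset.card_union_le`.

Folklore planar convex geometry over Mathlib and the landed exposed-direction lemma; no named facts, no citations,
no `def`s.
-/

-- Sub = Summit single-conjunct layout: the duplicated namespace component is mandated by the tree.
set_option linter.dupNamespace false

noncomputable section

open scoped BigOperators

namespace Summit.ValiantsHypothesis.ValiantsHypothesis.Theorems.NewtonUnitEquationsNewtonTauWeak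

namespace ShadowAdditivityAux

/-- A height `∑ i, w i * (s i : ℝ)` over `Fin 2` is `w 0 · x s + w 1 · y s`. [folklore] -/
theorem height_two (w : Fin 2 → ℝ) (s : Fin 2 →₀ ℕ) :
    ∑ i, w i * ((s i : ℕ) : ℝ) = w 0 * ((s 0 : ℕ) : ℝ) + w 1 * ((s 1 : ℕ) : ℝ) :=
  Fin.sum_univ_two _

/-- Dividing a strict height comparison `a·x + b·y < a·x' + b·y'` by `b > 0` normalises the `y`-coefficient
to `1`. [folklore] -/
theorem div_height_lt_of_pos {a b x y x' y' : ℝ} (hb : 0 < b) (h : a * x + b * y < a * x' + b * y') :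
    a / b * x + 1 * y < a / b * x' + 1 * y' := by
  have hb0 : b ≠ 0 := hb.ne'
  have key : ∀ u v : ℝ, b * (a / b * u + 1 * v) = a * u + b * v := fun u v => by
    calc b * (a / b * u + 1 * v) = a * u * (b * b⁻¹) + b * v := by ring
      _ = a * u + b * v := by rw [mul_inv_cancel₀ hb0, mul_one]
  refine lt_of_mul_lt_mul_left ?_ hb.le
  rwa [key, key]

/-- Dividing a strict height comparison `a·x + b·y < a·x' + b·y'` by `-b > 0` normalises the `y`-coefficient
to `-1`. [folklore] -/
theorem div_height_lt_of_neg {a b x y x' y' : ℝ} (hb : b < 0) (h : a * x + b * y < a * x' + b * y') :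
    a / (-b) * x + (-1) * y < a / (-b) * x' + (-1) * y' := by
  have hb' : 0 < -b := neg_pos.2 hb
  have hb0 : (-b) ≠ 0 := hb'.ne'
  have key : ∀ u v : ℝ, (-b) * (a / (-b) * u + (-1) * v) = a * u + b * v := fun u v => by
    calc (-b) * (a / (-b) * u + (-1) * v) = a * u * ((-b) * (-b)⁻¹) + b * v := by ring
      _ = a * u + b * v := by rw [mul_inv_cancel₀ hb0, mul_one]
  refine lt_of_mul_lt_mul_left ?_ hb'.le
  rwa [key, key]

/-- **Classification of hull vertices.**  Every extreme point of the convex hull of the embedding of a finite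
`S ⊆ ℕ²` is the image of a point of `S` which is either the unique maximiser of some height `t·x + y`
(`∈ U 1 S`), or of some height `t·x - y` (`∈ U (-1) S`), or the unique rightmost or the unique leftmost point of
`S`: strict exposure by a direction `w` (`stub_exposedGenericDirection`) and a case distinction on the signs of
`w 1` and `w 0`. [folklore] -/
theorem extremePoints_subset_image
    (U : ℝ → Finset (Fin 2 →₀ ℕ) → Finset (Fin 2 →₀ ℕ))
    (hU : ∀ (σ : ℝ) (S : Finset (Fin 2 →₀ ℕ)) (s : Fin 2 →₀ ℕ), s ∈ U σ S ↔ s ∈ S ∧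
      ∃ t : ℝ, ∀ s' ∈ S, s' ≠ s →
        t * ((s' 0 : ℕ) : ℝ) + σ * ((s' 1 : ℕ) : ℝ) < t * ((s 0 : ℕ) : ℝ) + σ * ((s 1 : ℕ) : ℝ))
    (S : Finset (Fin 2 →₀ ℕ)) :
    Set.extremePoints ℝ (convexHull ℝ ((fun e : Fin 2 →₀ ℕ => fun i : Fin 2 => ((e i : ℕ) : ℝ)) ''
      (S : Set (Fin 2 →₀ ℕ)))) ⊆
      (fun e : Fin 2 →₀ ℕ => fun i : Fin 2 => ((e i : ℕ) : ℝ)) ''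
        ((U 1 S ∪ U (-1) S ∪ (S.filter fun s => ∀ s' ∈ S, s' ≠ s → (s' 0 : ℕ) < (s 0 : ℕ)) ∪
          (S.filter fun s => ∀ s' ∈ S, s' ≠ s → (s 0 : ℕ) < (s' 0 : ℕ)) : Finset (Fin 2 →₀ ℕ)) :
            Set (Fin 2 →₀ ℕ)) := by
  intro e he
  obtain ⟨w, e₀, he₀S, rfl, hexp, -⟩ :=
    NewtonUnitEquationsDissociatedUniform.stub_exposedGenericDirection S ∅ e he
  refine Set.mem_image_of_mem _ (Finset.mem_coe.2 ?_)
  -- strict exposure, coordinates expanded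
  have hexp2 : ∀ s ∈ S, s ≠ e₀ →
      w 0 * ((s 0 : ℕ) : ℝ) + w 1 * ((s 1 : ℕ) : ℝ) < w 0 * ((e₀ 0 : ℕ) : ℝ) + w 1 * ((e₀ 1 : ℕ) : ℝ) := by
    intro s hs hne
    have h := hexp s hs hne
    rwa [height_two, height_two] at h
  rcases lt_trichotomy 0 (w 1) with h1 | h1 | h1
  · -- upper vertex
    exact Finset.mem_union_left _ (Finset.mem_union_left _ (Finset.mem_union_left _
      ((hU 1 S e₀).2 ⟨he₀S, w 0 / w 1, fun s' hs' hne => div_height_lt_of_pos h1 (hexp2 s' hs' hne)⟩)))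
  · rcases lt_trichotomy 0 (w 0) with h0 | h0 | h0
    · -- unique rightmost point
      refine Finset.mem_union_left _ (Finset.mem_union_right _ (Finset.mem_filter.2 ⟨he₀S, ?_⟩))
      intro s' hs' hne
      have h := hexp2 s' hs' hne
      rw [← h1, zero_mul, zero_mul, add_zero, add_zero] at h
      exact_mod_cast lt_of_mul_lt_mul_left h h0.le
    · -- `w = 0`: `S = {e₀}`, vacuously the unique rightmost point
      refine Finset.mem_union_left _ (Finset.mem_union_right _ (Finset.mem_filter.2 ⟨he₀S, ?_⟩))
      intro s' hs' hne
      have h := hexp2 s' hs' hne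
      rw [← h1, ← h0] at h
      simp at h
    · -- unique leftmost point
      refine Finset.mem_union_right _ (Finset.mem_filter.2 ⟨he₀S, ?_⟩)
      intro s' hs' hne
      have h := hexp2 s' hs' hne
      rw [← h1, zero_mul, zero_mul, add_zero, add_zero] at h
      exact_mod_cast lt_of_mul_lt_mul_of_nonpos_left h h0.le
  · -- lower vertex
    exact Finset.mem_union_left _ (Finset.mem_union_left _ (Finset.mem_union_right _
      ((hU (-1) S e₀).2
        ⟨he₀S, w 0 / (-w 1), fun s' hs' hne => div_height_lt_of_neg h1 (hexp2 s' hs' hne)⟩)))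

end ShadowAdditivityAux

/-- **Hull vertices versus unique maximisers, registered stub `ncard_extremePoints_le_card_uniqueMax`.**  For a
finite `S ⊆ ℕ²` and the operator `U σ S` of points of `S` uniquely maximising some height `t·x + σ·y` over `S`,
the convex hull of the real embedding of `S` has at most `|U 1 S| + |U (-1) S| + 2` extreme points: by
`ShadowAdditivityAux.extremePoints_subset_image` the extreme points lie in the image of
`U 1 S ∪ U (-1) S ∪ Mx ∪ Mn` with `Mx` (unique rightmost points) and `Mn` (unique leftmost points) of cardinality
at most one each. [folklore] -/
theorem ncard_extremePoints_le_card_uniqueMax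
    (U : ℝ → Finset (Fin 2 →₀ ℕ) → Finset (Fin 2 →₀ ℕ))
    (hU : ∀ (σ : ℝ) (S : Finset (Fin 2 →₀ ℕ)) (s : Fin 2 →₀ ℕ), s ∈ U σ S ↔ s ∈ S ∧
      ∃ t : ℝ, ∀ s' ∈ S, s' ≠ s →
        t * ((s' 0 : ℕ) : ℝ) + σ * ((s' 1 : ℕ) : ℝ) < t * ((s 0 : ℕ) : ℝ) + σ * ((s 1 : ℕ) : ℝ))
    (S : Finset (Fin 2 →₀ ℕ)) :
    (Set.extremePoints ℝ (convexHull ℝ ((fun e : Fin 2 →₀ ℕ => fun i : Fin 2 => ((e i : ℕ) : ℝ)) ''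
      (S : Set (Fin 2 →₀ ℕ))))).ncard ≤ (U 1 S).card + (U (-1) S).card + 2 := by
  classical
  refine (Set.ncard_le_ncard (ShadowAdditivityAux.extremePoints_subset_image U hU S)
    ((Finset.finite_toSet _).image _)).trans ?_
  refine (Set.ncard_image_le (Finset.finite_toSet _)).trans ?_
  rw [Set.ncard_coe_finset]
  -- at most one unique rightmost point, at most one unique leftmost point
  have hMx : (S.filter fun s => ∀ s' ∈ S, s' ≠ s → (s' 0 : ℕ) < (s 0 : ℕ)).card ≤ 1 :=
    Finset.card_le_one.2 fun a ha b hb => by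
      by_contra hab
      exact lt_asymm ((Finset.mem_filter.1 ha).2 b (Finset.mem_filter.1 hb).1 (Ne.symm hab))
        ((Finset.mem_filter.1 hb).2 a (Finset.mem_filter.1 ha).1 hab)
  have hMn : (S.filter fun s => ∀ s' ∈ S, s' ≠ s → (s 0 : ℕ) < (s' 0 : ℕ)).card ≤ 1 :=
    Finset.card_le_one.2 fun a ha b hb => by
      by_contra hab
      exact lt_asymm ((Finset.mem_filter.1 ha).2 b (Finset.mem_filter.1 hb).1 (Ne.symm hab))
        ((Finset.mem_filter.1 hb).2 a (Finset.mem_filter.1 ha).1 hab)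
  refine (Finset.card_union_le _ _).trans ?_
  refine (Nat.add_le_add ((Finset.card_union_le _ _).trans
    (Nat.add_le_add (Finset.card_union_le _ _) hMx)) hMn).trans ?_
  omega

end Summit.ValiantsHypothesis.ValiantsHypothesis.Theorems.NewtonUnitEquationsNewtonTauWeak

end
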